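import Literature.Analysis.FluidPDE.GaussianVortexFormDomainConstants
import Mathlib.MeasureTheory.Function.ConvergenceInMeasure
import HarnessLib

/-!
# The moment bound `‖|x| u‖_{L²(μ_λ)} ≲ ‖(u, ∇u)‖_{H¹(μ_λ)}` on the form domain of `L_λ`

Analysis/FluidPDE file (all results proved, no definitions, no named facts), part of the theory
of the form domain `H¹(μ_λ)` (`GaussianVortexFormDomain`) behind the named fact
`GallayMaekawa2016_thm41` (Gallay–Maekawa 2016, Thm. 4.1). In the ground-state variables the weak
gradient of a vorticity `w = ρ_λ u` is `∇w = ρ_λ(∇u − u b_λ)` with the unbounded drift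
`b_λ(x) = ((1+λ)x₀/2, (1−λ)x₁/2)`, `|b_λ(x)| ≤ |x|`; to control it one needs a moment of `u`:

* `lintegral_weight_mul_sq_le_of_tendsto_Lp` — **lower semicontinuity (Fatou) of weighted
  square integrals under `L²` convergence**: if `fₙ → g` in `L²(μ)` and
  `∫⁻ ω fₙ² ≤ Cₙ → c`, then `∫⁻ ω g² ≤ c` (subsequence converging a.e. + Fatou); the tool for passing
  pointwise estimates from test functions to the closure `H¹(μ_λ)`;
* `integral_drift_sq_mul_sq_expNegQuadLam_eq` — the virial identity
  `∫ (x·b_λ) φ² ρ_λ = ∫ (2φ Dφ(x)[x] + 2φ²) ρ_λ` for test functions (`x·∇ρ_λ = −(x·b_λ)ρ_λ` and one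
  integration by parts per coordinate);
* `integral_norm_sq_mul_sq_mul_expNegQuadLam_le` — **moment bound for test functions**:
  `∫ |x|² φ² ρ_λ ≤ (16/(1−λ)²) ∫ ‖Dφ‖² ρ_λ + (8/(1−λ)) ∫ φ² ρ_λ`;
* `integral_norm_sq_mul_sq_le_of_mem_gaussLamFormDomain` — **moment bound on `H¹(μ_λ)`**: for
  `U = (u, ∇u) ∈ H¹(μ_λ)`, `|x|² u² ρ_λ` is integrable and
  `∫ |x|² u² ρ_λ ≤ (16/(1−λ)²) ‖∇u‖² + (8/(1−λ)) ‖u‖²`.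

## References

* Th. Gallay, Y. Maekawa, *Existence and stability of viscous vortices*, arXiv:1610.08384, §4.1,
  (4.6) (the weight `ρ(x) = (1+|x|²)^{1/2}` in `W^{1,2}(∞;λ)`). [GallayMaekawa2016]
-/

open MeasureTheory Filter Set WithLp Metric
open scoped Real RealInnerProductSpace Topology InnerProductSpace ContDiff ENNReal

noncomputable section

namespace Literature.Analysis.FluidPDE

open Literature.Analysis.UnboundedOperators

/-! ### Fatou for weighted squares under `L²` convergence -/

/-- **Lower semicontinuity of weighted square integrals under `L²(μ)`-convergence.** If
`fₙ → g` in `L²(μ)`, `wt ≥ 0` is measurable and `∫⁻ wt·fₙ² dμ ≤ Cₙ` with `Cₙ → c`, then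
`∫⁻ wt·g² dμ ≤ c`: a subsequence converges a.e. (`TendstoInMeasure.exists_seq_tendsto_ae`) and
Fatou's lemma applies. [folklore] -/
theorem lintegral_weight_mul_sq_le_of_tendsto_Lp {X : Type*} [MeasurableSpace X] {μ : Measure X}
    {f : ℕ → Lp ℝ 2 μ} {g : Lp ℝ 2 μ} (hfg : Tendsto f atTop (𝓝 g))
    {wt : X → ℝ} (hwt : Measurable wt) {C : ℕ → ℝ} {c : ℝ}
    (hC : ∀ n, ∫⁻ x, ENNReal.ofReal (wt x * (f n : X → ℝ) x ^ 2) ∂μ ≤ ENNReal.ofReal (C n))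
    (hCl : Tendsto C atTop (𝓝 c)) :
    ∫⁻ x, ENNReal.ofReal (wt x * (g : X → ℝ) x ^ 2) ∂μ ≤ ENNReal.ofReal c := by
  obtain ⟨ns, hns, hae⟩ := (tendstoInMeasure_of_tendsto_Lp hfg).exists_seq_tendsto_ae
  have hFm : ∀ i, AEMeasurable (fun x => ENNReal.ofReal (wt x * (f (ns i) : X → ℝ) x ^ 2)) μ :=
    fun i => (hwt.aemeasurable.mul
      ((Lp.aestronglyMeasurable (f (ns i))).aemeasurable.pow_const 2)).ennreal_ofReal
  have hlim : ∀ᵐ x ∂μ, Tendsto (fun i => ENNReal.ofReal (wt x * (f (ns i) : X → ℝ) x ^ 2)) atTop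
      (𝓝 (ENNReal.ofReal (wt x * (g : X → ℝ) x ^ 2))) := by
    filter_upwards [hae] with x hx
    exact ENNReal.tendsto_ofReal ((hx.pow 2).const_mul (wt x))
  calc ∫⁻ x, ENNReal.ofReal (wt x * (g : X → ℝ) x ^ 2) ∂μ
      = ∫⁻ x, liminf (fun i => ENNReal.ofReal (wt x * (f (ns i) : X → ℝ) x ^ 2)) atTop ∂μ :=
        lintegral_congr_ae (hlim.mono fun x hx => hx.liminf_eq.symm)
    _ ≤ liminf (fun i => ∫⁻ x, ENNReal.ofReal (wt x * (f (ns i) : X → ℝ) x ^ 2) ∂μ) atTop :=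
        lintegral_liminf_le' hFm
    _ ≤ liminf (fun i => ENNReal.ofReal (C (ns i))) atTop :=
        liminf_le_liminf (Eventually.of_forall fun i => hC (ns i))
    _ = ENNReal.ofReal c := ((ENNReal.tendsto_ofReal hCl).comp hns.tendsto_atTop).liminf_eq

/-! ### The virial identity and the moment bound for test functions -/

section TestFunction

variable {lam : ℝ} (hlam : lam ∈ Set.Ico (0 : ℝ) 1)
include hlam

omit hlam in
/-- One integration by parts: `∫ (κᵢxᵢ²/2) φ² ρ_λ = ∫ (2φ ∂ᵢφ xᵢ + φ²) ρ_λ` for the coordinate `i`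
with `∂ᵢρ_λ = −(κᵢxᵢ/2)ρ_λ`. [folklore] -/
theorem integral_coord_sq_mul_sq_mul_expNegQuadLam_eq (φ : planarTestFunctions) (i : Fin 2) {κ : ℝ}
    (hρi : ∀ x : EuclideanSpace ℝ (Fin 2), fderiv ℝ (fun y : EuclideanSpace ℝ (Fin 2) =>
      Real.exp (-((1 + lam) / 4 * y 0 ^ 2 + (1 - lam) / 4 * y 1 ^ 2))) x (EuclideanSpace.single i 1) =
      -(κ * x i / 2) * Real.exp (-((1 + lam) / 4 * x 0 ^ 2 + (1 - lam) / 4 * x 1 ^ 2))) :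
    ∫ x : EuclideanSpace ℝ (Fin 2), κ * x i ^ 2 / 2 * (φ : EuclideanSpace ℝ (Fin 2) → ℝ) x ^ 2 *
        Real.exp (-((1 + lam) / 4 * x 0 ^ 2 + (1 - lam) / 4 * x 1 ^ 2)) =
      ∫ x : EuclideanSpace ℝ (Fin 2),
        (2 * (φ : EuclideanSpace ℝ (Fin 2) → ℝ) x *
            fderiv ℝ (φ : EuclideanSpace ℝ (Fin 2) → ℝ) x (EuclideanSpace.single i 1) * x i +
          (φ : EuclideanSpace ℝ (Fin 2) → ℝ) x ^ 2) *
        Real.exp (-((1 + lam) / 4 * x 0 ^ 2 + (1 - lam) / 4 * x 1 ^ 2)) := by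
  set ρ : EuclideanSpace ℝ (Fin 2) → ℝ := fun y =>
    Real.exp (-((1 + lam) / 4 * y 0 ^ 2 + (1 - lam) / 4 * y 1 ^ 2)) with hρ
  set ψ : EuclideanSpace ℝ (Fin 2) → ℝ := (φ : EuclideanSpace ℝ (Fin 2) → ℝ) with hψ
  have hψc : ContDiff ℝ ∞ ψ := planarTestFunctions.contDiff φ
  have hψs : HasCompactSupport ψ := planarTestFunctions.hasCompactSupport φ
  have hψd : Differentiable ℝ ψ := hψc.differentiable (by simp)
  have hρc : Continuous ρ := continuous_expNegQuadLam lam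
  have hρd : Differentiable ℝ ρ := (contDiff_exp_neg_quadraticLam lam (n := 1)).differentiable one_ne_zero
  -- `f = φ² xᵢ`
  set f : EuclideanSpace ℝ (Fin 2) → ℝ := fun x => ψ x ^ 2 * x i with hf
  have hcoord : ∀ x : EuclideanSpace ℝ (Fin 2), HasFDerivAt (fun y : EuclideanSpace ℝ (Fin 2) => y i)
      (EuclideanSpace.proj i : EuclideanSpace ℝ (Fin 2) →L[ℝ] ℝ) x := fun x =>
    (EuclideanSpace.proj i : EuclideanSpace ℝ (Fin 2) →L[ℝ] ℝ).hasFDerivAt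
  have hfd : ∀ x, HasFDerivAt f ((ψ x ^ 2) • (EuclideanSpace.proj i : EuclideanSpace ℝ (Fin 2) →L[ℝ] ℝ) +
      (x i) • ((2 * ψ x) • fderiv ℝ ψ x)) x := by
    intro x
    have h1 : HasFDerivAt (fun y => ψ y ^ 2) ((2 * ψ x) • fderiv ℝ ψ x) x := by
      have := ((hψd x).hasFDerivAt).pow 2
      simpa using this
    exact h1.mul (hcoord x)
  have hf' : ∀ x, fderiv ℝ f x (EuclideanSpace.single i 1) = 2 * ψ x *
      fderiv ℝ ψ x (EuclideanSpace.single i 1) * x i + ψ x ^ 2 := by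
    intro x
    rw [(hfd x).fderiv]
    simp
    ring
  have hfc : Continuous f := (hψc.continuous.pow 2).mul (PiLp.continuous_apply 2 _ i)
  have hfs : HasCompactSupport f := hψs.mono (by
    intro x hx
    simp only [Function.mem_support, ne_eq, hf] at hx ⊢
    contrapose! hx
    simp [hx])
  have hρ1c : Continuous fun x => fderiv ℝ ρ x (EuclideanSpace.single i 1) :=
    ((contDiff_exp_neg_quadraticLam lam (n := 1)).continuous_fderiv one_ne_zero).clm_apply
      continuous_const
  have hψ1c : Continuous fun x => fderiv ℝ ψ x (EuclideanSpace.single i 1) :=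
    (hψc.continuous_fderiv (by simp)).clm_apply continuous_const
  -- the derivative of `f` along `eᵢ`, as a function with compact support
  have hf'fun : (fun x => fderiv ℝ f x (EuclideanSpace.single i 1) * ρ x) =
      fun x => (2 * ψ x * fderiv ℝ ψ x (EuclideanSpace.single i 1) * x i + ψ x ^ 2) * ρ x := by
    funext x; rw [hf']
  have hgs : HasCompactSupport fun x : EuclideanSpace ℝ (Fin 2) =>
      (2 * ψ x * fderiv ℝ ψ x (EuclideanSpace.single i 1) * x i + ψ x ^ 2) * ρ x := hψs.mono (by
    intro x hx
    simp only [Function.mem_support, ne_eq] at hx ⊢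
    contrapose! hx
    simp [hx])
  have i1 : Integrable fun x => fderiv ℝ f x (EuclideanSpace.single i 1) * ρ x := by
    rw [hf'fun]
    exact ((((continuous_const.mul hψc.continuous).mul hψ1c).mul
      (PiLp.continuous_apply 2 _ i)).add (hψc.continuous.pow 2)).mul hρc
      |>.integrable_of_hasCompactSupport hgs
  have i2 : Integrable fun x => f x * fderiv ℝ ρ x (EuclideanSpace.single i 1) :=
    (hfc.mul hρ1c).integrable_of_hasCompactSupport hfs.mul_right
  have i3 : Integrable fun x => f x * ρ x :=
    (hfc.mul hρc).integrable_of_hasCompactSupport hfs.mul_right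
  have hibp := integral_mul_fderiv_eq_neg_fderiv_mul_of_integrable i1 i2 i3
    (fun x _ => (hfd x).differentiableAt) (fun x _ => hρd x)
  calc ∫ x : EuclideanSpace ℝ (Fin 2), κ * x i ^ 2 / 2 * ψ x ^ 2 * ρ x
      = -∫ x, f x * fderiv ℝ ρ x (EuclideanSpace.single i 1) := by
        rw [← integral_neg]
        refine integral_congr_ae (Eventually.of_forall fun x => ?_)
        show κ * x i ^ 2 / 2 * ψ x ^ 2 * ρ x = -(ψ x ^ 2 * x i *
          fderiv ℝ (fun y : EuclideanSpace ℝ (Fin 2) =>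
            Real.exp (-((1 + lam) / 4 * y 0 ^ 2 + (1 - lam) / 4 * y 1 ^ 2))) x
            (EuclideanSpace.single i 1))
        rw [hρi]
        show κ * x i ^ 2 / 2 * ψ x ^ 2 * ρ x = -(ψ x ^ 2 * x i * (-(κ * x i / 2) * ρ x))
        ring
    _ = ∫ x, fderiv ℝ f x (EuclideanSpace.single i 1) * ρ x := by rw [hibp, neg_neg]
    _ = _ := by rw [hf'fun]

omit hlam in
/-- **The virial identity for `ρ_λ`**: for a test function `φ`,
`∫ ((1+λ)x₀² + (1−λ)x₁²)/2 · φ² ρ_λ = ∫ (2φ (x₀∂₀φ + x₁∂₁φ) + 2φ²) ρ_λ`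
(`x·∇ρ_λ = −(x·b_λ)ρ_λ`, `div(φ²x) = 2φ x·∇φ + 2φ²`). [folklore] -/
theorem integral_drift_sq_mul_sq_expNegQuadLam_eq (φ : planarTestFunctions) :
    ∫ x : EuclideanSpace ℝ (Fin 2), ((1 + lam) * x 0 ^ 2 / 2 + (1 - lam) * x 1 ^ 2 / 2) *
        (φ : EuclideanSpace ℝ (Fin 2) → ℝ) x ^ 2 *
        Real.exp (-((1 + lam) / 4 * x 0 ^ 2 + (1 - lam) / 4 * x 1 ^ 2)) =
      ∫ x : EuclideanSpace ℝ (Fin 2),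
        (2 * (φ : EuclideanSpace ℝ (Fin 2) → ℝ) x *
            (x 0 * fderiv ℝ (φ : EuclideanSpace ℝ (Fin 2) → ℝ) x (EuclideanSpace.single 0 1) +
              x 1 * fderiv ℝ (φ : EuclideanSpace ℝ (Fin 2) → ℝ) x (EuclideanSpace.single 1 1)) +
          2 * (φ : EuclideanSpace ℝ (Fin 2) → ℝ) x ^ 2) *
        Real.exp (-((1 + lam) / 4 * x 0 ^ 2 + (1 - lam) / 4 * x 1 ^ 2)) := by
  have h0 := integral_coord_sq_mul_sq_mul_expNegQuadLam_eq (lam := lam) φ 0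
    (fderiv_exp_neg_quadraticLam_zero lam)
  have h1 := integral_coord_sq_mul_sq_mul_expNegQuadLam_eq (lam := lam) φ 1
    (fderiv_exp_neg_quadraticLam_one lam)
  set ρ : EuclideanSpace ℝ (Fin 2) → ℝ := fun y =>
    Real.exp (-((1 + lam) / 4 * y 0 ^ 2 + (1 - lam) / 4 * y 1 ^ 2)) with hρ
  set ψ : EuclideanSpace ℝ (Fin 2) → ℝ := (φ : EuclideanSpace ℝ (Fin 2) → ℝ) with hψ
  have hψc : ContDiff ℝ ∞ ψ := planarTestFunctions.contDiff φ
  have hψs : HasCompactSupport ψ := planarTestFunctions.hasCompactSupport φ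
  have hρc : Continuous ρ := continuous_expNegQuadLam lam
  have hψ1c : ∀ j : Fin 2, Continuous fun x => fderiv ℝ ψ x (EuclideanSpace.single j 1) := fun j =>
    (hψc.continuous_fderiv (by simp)).clm_apply continuous_const
  -- integrability of the four integrands (continuous, compact support)
  have iL : ∀ (j : Fin 2) (κ : ℝ), Integrable fun x : EuclideanSpace ℝ (Fin 2) =>
      κ * x j ^ 2 / 2 * ψ x ^ 2 * ρ x := fun j κ =>
    (((((continuous_const.mul ((PiLp.continuous_apply 2 _ j).pow 2)).div_const _).mul
      (hψc.continuous.pow 2)).mul hρc).integrable_of_hasCompactSupport (hψs.mono (by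
        intro x hx
        simp only [Function.mem_support, ne_eq] at hx ⊢
        contrapose! hx
        simp [hx])))
  have iR : ∀ j : Fin 2, Integrable fun x : EuclideanSpace ℝ (Fin 2) =>
      (2 * ψ x * fderiv ℝ ψ x (EuclideanSpace.single j 1) * x j + ψ x ^ 2) * ρ x := fun j =>
    (((((continuous_const.mul hψc.continuous).mul (hψ1c j)).mul
      (PiLp.continuous_apply 2 _ j)).add (hψc.continuous.pow 2)).mul hρc).integrable_of_hasCompactSupport
      (hψs.mono (by
        intro x hx
        simp only [Function.mem_support, ne_eq] at hx ⊢
        contrapose! hx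
        simp [hx]))
  have eL : ∫ x : EuclideanSpace ℝ (Fin 2), ((1 + lam) * x 0 ^ 2 / 2 + (1 - lam) * x 1 ^ 2 / 2) *
        ψ x ^ 2 * ρ x =
      (∫ x : EuclideanSpace ℝ (Fin 2), (1 + lam) * x 0 ^ 2 / 2 * ψ x ^ 2 * ρ x) +
        ∫ x : EuclideanSpace ℝ (Fin 2), (1 - lam) * x 1 ^ 2 / 2 * ψ x ^ 2 * ρ x := by
    rw [← integral_add (iL 0 _) (iL 1 _)]
    refine integral_congr_ae (Eventually.of_forall fun x => ?_)
    ring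
  have eR : ∫ x : EuclideanSpace ℝ (Fin 2), (2 * ψ x *
        (x 0 * fderiv ℝ ψ x (EuclideanSpace.single 0 1) + x 1 * fderiv ℝ ψ x (EuclideanSpace.single 1 1)) +
          2 * ψ x ^ 2) * ρ x =
      (∫ x : EuclideanSpace ℝ (Fin 2),
        (2 * ψ x * fderiv ℝ ψ x (EuclideanSpace.single 0 1) * x 0 + ψ x ^ 2) * ρ x) +
        ∫ x : EuclideanSpace ℝ (Fin 2),
          (2 * ψ x * fderiv ℝ ψ x (EuclideanSpace.single 1 1) * x 1 + ψ x ^ 2) * ρ x := by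
    rw [← integral_add (iR 0) (iR 1)]
    refine integral_congr_ae (Eventually.of_forall fun x => ?_)
    ring
  rw [eL, eR, h0, h1]

/-- **Moment bound for test functions**: for `0 ≤ λ < 1` and a test function `φ`,
`∫ |x|² φ² ρ_λ ≤ (16/(1−λ)²) ∫ ‖Dφ‖² ρ_λ + (8/(1−λ)) ∫ φ² ρ_λ`. From the virial identity:
`(1−λ)/2 |x|² ≤ x·b_λ` and `2φ Dφ(x)[x] ≤ ((1−λ)/4)|x|²φ² + (4/(1−λ))‖Dφ‖²`. [folklore] -/
theorem integral_norm_sq_mul_sq_mul_expNegQuadLam_le (φ : planarTestFunctions) :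
    ∫ x : EuclideanSpace ℝ (Fin 2), ‖x‖ ^ 2 * (φ : EuclideanSpace ℝ (Fin 2) → ℝ) x ^ 2 *
        Real.exp (-((1 + lam) / 4 * x 0 ^ 2 + (1 - lam) / 4 * x 1 ^ 2)) ≤
      16 / (1 - lam) ^ 2 * (∫ x : EuclideanSpace ℝ (Fin 2),
        ‖fderiv ℝ (φ : EuclideanSpace ℝ (Fin 2) → ℝ) x‖ ^ 2 *
          Real.exp (-((1 + lam) / 4 * x 0 ^ 2 + (1 - lam) / 4 * x 1 ^ 2))) +
      8 / (1 - lam) * ∫ x : EuclideanSpace ℝ (Fin 2), (φ : EuclideanSpace ℝ (Fin 2) → ℝ) x ^ 2 *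
          Real.exp (-((1 + lam) / 4 * x 0 ^ 2 + (1 - lam) / 4 * x 1 ^ 2)) := by
  obtain ⟨hl0, hl1⟩ := hlam
  have hq : 0 < 1 - lam := by linarith
  have hvir := integral_drift_sq_mul_sq_expNegQuadLam_eq (lam := lam) φ
  set ρ : EuclideanSpace ℝ (Fin 2) → ℝ := fun y =>
    Real.exp (-((1 + lam) / 4 * y 0 ^ 2 + (1 - lam) / 4 * y 1 ^ 2)) with hρ
  set ψ : EuclideanSpace ℝ (Fin 2) → ℝ := (φ : EuclideanSpace ℝ (Fin 2) → ℝ) with hψ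
  have hρpos : ∀ x, 0 < ρ x := fun x => Real.exp_pos _
  have hψc : ContDiff ℝ ∞ ψ := planarTestFunctions.contDiff φ
  have hψs : HasCompactSupport ψ := planarTestFunctions.hasCompactSupport φ
  have hρc : Continuous ρ := continuous_expNegQuadLam lam
  have hψ1c : ∀ j : Fin 2, Continuous fun x => fderiv ℝ ψ x (EuclideanSpace.single j 1) := fun j =>
    (hψc.continuous_fderiv (by simp)).clm_apply continuous_const
  have hDc : Continuous fun x => ‖fderiv ℝ ψ x‖ := (hψc.continuous_fderiv (by simp)).norm
  have hsupp : ∀ {F : EuclideanSpace ℝ (Fin 2) → ℝ}, (∀ x, ψ x = 0 → F x = 0) → HasCompactSupport F :=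
    fun hF => hψs.mono (by
      intro x hx
      simp only [Function.mem_support, ne_eq] at hx ⊢
      contrapose! hx
      exact hF x hx)
  -- the three integrals on the right are of compactly supported continuous functions
  have iX : Integrable fun x : EuclideanSpace ℝ (Fin 2) => ‖x‖ ^ 2 * ψ x ^ 2 * ρ x :=
    (((continuous_norm.pow 2).mul (hψc.continuous.pow 2)).mul hρc).integrable_of_hasCompactSupport
      (hsupp fun x hx => by simp [hx])
  have iN : Integrable fun x : EuclideanSpace ℝ (Fin 2) => ψ x ^ 2 * ρ x :=
    ((hψc.continuous.pow 2).mul hρc).integrable_of_hasCompactSupport (hsupp fun x hx => by simp [hx])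
  have iD : Integrable fun x : EuclideanSpace ℝ (Fin 2) => ‖fderiv ℝ ψ x‖ ^ 2 * ρ x := by
    refine ((hDc.pow 2).mul hρc).integrable_of_hasCompactSupport ?_
    refine (hψs.fderiv (𝕜 := ℝ)).mono ?_
    intro x hx
    simp only [Function.mem_support, ne_eq] at hx ⊢
    contrapose! hx
    simp [hx]
  -- lower bound of the left side of the virial identity
  have hlow : (1 - lam) / 2 * ∫ x : EuclideanSpace ℝ (Fin 2), ‖x‖ ^ 2 * ψ x ^ 2 * ρ x ≤
      ∫ x : EuclideanSpace ℝ (Fin 2), ((1 + lam) * x 0 ^ 2 / 2 + (1 - lam) * x 1 ^ 2 / 2) *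
        ψ x ^ 2 * ρ x := by
    rw [← integral_const_mul]
    refine integral_mono (iX.const_mul _) ?_ fun x => ?_
    · exact (((((continuous_const.mul ((PiLp.continuous_apply 2 _ 0).pow 2)).div_const _).add
        ((continuous_const.mul ((PiLp.continuous_apply 2 _ 1).pow 2)).div_const _)).mul
        (hψc.continuous.pow 2)).mul hρc).integrable_of_hasCompactSupport (hsupp fun x hx => by simp [hx])
    · have hn : ‖x‖ ^ 2 = x 0 ^ 2 + x 1 ^ 2 := by
        rw [EuclideanSpace.norm_sq_eq]; simp [Fin.sum_univ_two]
      rw [hn]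
      have h2 := mul_nonneg (sq_nonneg (ψ x)) (hρpos x).le
      nlinarith [sq_nonneg (x 0), sq_nonneg (x 1), h2, mul_nonneg (sq_nonneg (x 0)) h2]
  -- upper bound of the right side, pointwise `2φ Dφ(x)[x] ≤ ε|x|²φ² + ε⁻¹‖Dφ‖²`, `ε = (1−λ)/4`
  have hε : 0 < (1 - lam) / 4 := by positivity
  have hεinv : ((1 - lam) / 4)⁻¹ = 4 / (1 - lam) := by rw [inv_div]
  have hpt : ∀ x : EuclideanSpace ℝ (Fin 2), (2 * ψ x *
        (x 0 * fderiv ℝ ψ x (EuclideanSpace.single 0 1) + x 1 * fderiv ℝ ψ x (EuclideanSpace.single 1 1)) +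
          2 * ψ x ^ 2) * ρ x ≤
      (1 - lam) / 4 * (‖x‖ ^ 2 * ψ x ^ 2 * ρ x) + 4 / (1 - lam) * (‖fderiv ℝ ψ x‖ ^ 2 * ρ x) +
        2 * (ψ x ^ 2 * ρ x) := by
    intro x
    have hDx : x 0 * fderiv ℝ ψ x (EuclideanSpace.single 0 1) +
        x 1 * fderiv ℝ ψ x (EuclideanSpace.single 1 1) = fderiv ℝ ψ x x := by
      have e : x = x 0 • EuclideanSpace.single 0 (1 : ℝ) + x 1 • EuclideanSpace.single 1 (1 : ℝ) := by
        ext j; fin_cases j <;> simp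
      have h := congrArg (fderiv ℝ ψ x) e
      rw [map_add, map_smul, map_smul, smul_eq_mul, smul_eq_mul] at h
      exact h.symm
    rw [hDx]
    have hb : |fderiv ℝ ψ x x| ≤ ‖fderiv ℝ ψ x‖ * ‖x‖ := by
      rw [← Real.norm_eq_abs]; exact (fderiv ℝ ψ x).le_opNorm x
    -- `A = |φ| |x|`, `B = ‖Dφ‖`
    set A : ℝ := |ψ x| * ‖x‖ with hA
    set B : ℝ := ‖fderiv ℝ ψ x‖ with hB
    have hA0 : 0 ≤ A := by positivity
    have hB0 : 0 ≤ B := norm_nonneg _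
    have hab : 2 * ψ x * fderiv ℝ ψ x x ≤ 2 * A * B := by
      have h1 : |ψ x * fderiv ℝ ψ x x| ≤ A * B := by
        rw [abs_mul, hA, hB, mul_assoc, mul_comm ‖x‖]
        exact mul_le_mul_of_nonneg_left hb (abs_nonneg _)
      have h2 := (abs_le.1 h1).2
      linarith
    have hamgm : 2 * A * B ≤ (1 - lam) / 4 * A ^ 2 + 4 / (1 - lam) * B ^ 2 := by
      rw [show (1 - lam) / 4 * A ^ 2 + 4 / (1 - lam) * B ^ 2 =
          (((1 - lam) / 4) ^ 2 * A ^ 2 + B ^ 2) / ((1 - lam) / 4) by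
            rw [eq_div_iff hε.ne']; field_simp,
        le_div_iff₀ hε]
      nlinarith [sq_nonneg ((1 - lam) / 4 * A - B)]
    have hA2 : A ^ 2 = ‖x‖ ^ 2 * ψ x ^ 2 := by rw [hA, mul_pow, sq_abs]; ring
    have hρx := (hρpos x).le
    have key : 2 * ψ x * fderiv ℝ ψ x x ≤
        (1 - lam) / 4 * (‖x‖ ^ 2 * ψ x ^ 2) + 4 / (1 - lam) * ‖fderiv ℝ ψ x‖ ^ 2 := by
      rw [← hA2, ← hB]; exact hab.trans hamgm
    have := mul_le_mul_of_nonneg_right key hρx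
    nlinarith [this, hρx, sq_nonneg (ψ x)]
  have hup : ∫ x : EuclideanSpace ℝ (Fin 2), (2 * ψ x *
        (x 0 * fderiv ℝ ψ x (EuclideanSpace.single 0 1) + x 1 * fderiv ℝ ψ x (EuclideanSpace.single 1 1)) +
          2 * ψ x ^ 2) * ρ x ≤
      (1 - lam) / 4 * (∫ x : EuclideanSpace ℝ (Fin 2), ‖x‖ ^ 2 * ψ x ^ 2 * ρ x) +
        4 / (1 - lam) * (∫ x : EuclideanSpace ℝ (Fin 2), ‖fderiv ℝ ψ x‖ ^ 2 * ρ x) +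
        2 * ∫ x : EuclideanSpace ℝ (Fin 2), ψ x ^ 2 * ρ x := by
    have hsum : (1 - lam) / 4 * (∫ x : EuclideanSpace ℝ (Fin 2), ‖x‖ ^ 2 * ψ x ^ 2 * ρ x) +
        4 / (1 - lam) * (∫ x : EuclideanSpace ℝ (Fin 2), ‖fderiv ℝ ψ x‖ ^ 2 * ρ x) +
        2 * (∫ x : EuclideanSpace ℝ (Fin 2), ψ x ^ 2 * ρ x) =
        ∫ x : EuclideanSpace ℝ (Fin 2), ((1 - lam) / 4 * (‖x‖ ^ 2 * ψ x ^ 2 * ρ x) +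
          4 / (1 - lam) * (‖fderiv ℝ ψ x‖ ^ 2 * ρ x) + 2 * (ψ x ^ 2 * ρ x)) := by
      have iAB : Integrable fun x : EuclideanSpace ℝ (Fin 2) =>
          (1 - lam) / 4 * (‖x‖ ^ 2 * ψ x ^ 2 * ρ x) + 4 / (1 - lam) * (‖fderiv ℝ ψ x‖ ^ 2 * ρ x) :=
        (iX.const_mul _).add (iD.const_mul _)
      rw [integral_add iAB (iN.const_mul _), integral_add (iX.const_mul _) (iD.const_mul _),
        integral_const_mul, integral_const_mul, integral_const_mul]
    rw [hsum]
    refine integral_mono ?_ (((iX.const_mul _).add (iD.const_mul _)).add (iN.const_mul _)) hpt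
    exact ((((continuous_const.mul hψc.continuous).mul
      (((PiLp.continuous_apply 2 _ 0).mul (hψ1c 0)).add ((PiLp.continuous_apply 2 _ 1).mul
        (hψ1c 1)))).add (continuous_const.mul (hψc.continuous.pow 2))).mul hρc)
      |>.integrable_of_hasCompactSupport (hsupp fun x hx => by simp [hx])
  -- combine
  have hfin : (1 - lam) / 2 * (∫ x : EuclideanSpace ℝ (Fin 2), ‖x‖ ^ 2 * ψ x ^ 2 * ρ x) ≤
      (1 - lam) / 4 * (∫ x : EuclideanSpace ℝ (Fin 2), ‖x‖ ^ 2 * ψ x ^ 2 * ρ x) +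
        4 / (1 - lam) * (∫ x : EuclideanSpace ℝ (Fin 2), ‖fderiv ℝ ψ x‖ ^ 2 * ρ x) +
        2 * ∫ x : EuclideanSpace ℝ (Fin 2), ψ x ^ 2 * ρ x :=
    hlow.trans (hvir.le.trans hup)
  have hD0 : 0 ≤ ∫ x : EuclideanSpace ℝ (Fin 2), ‖fderiv ℝ ψ x‖ ^ 2 * ρ x :=
    integral_nonneg fun x => mul_nonneg (sq_nonneg _) (hρpos x).le
  have hN0 : 0 ≤ ∫ x : EuclideanSpace ℝ (Fin 2), ψ x ^ 2 * ρ x :=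
    integral_nonneg fun x => mul_nonneg (sq_nonneg _) (hρpos x).le
  rw [show 16 / (1 - lam) ^ 2 * (∫ x : EuclideanSpace ℝ (Fin 2), ‖fderiv ℝ ψ x‖ ^ 2 * ρ x) +
      8 / (1 - lam) * (∫ x : EuclideanSpace ℝ (Fin 2), ψ x ^ 2 * ρ x) =
      (4 / (1 - lam) * (∫ x : EuclideanSpace ℝ (Fin 2), ‖fderiv ℝ ψ x‖ ^ 2 * ρ x) +
        2 * ∫ x : EuclideanSpace ℝ (Fin 2), ψ x ^ 2 * ρ x) / ((1 - lam) / 4) by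
      field_simp; ring]
  rw [le_div_iff₀ hε]
  linarith

end TestFunction

/-! ### The moment bound on `H¹(μ_λ)` -/

section FormDomain

variable {lam : ℝ} (hlam : lam ∈ Set.Ico (0 : ℝ) 1)
include hlam

omit hlam in
/-- Elements of `H¹(μ_λ)` are limits of graphs of test functions (sequential form). [folklore] -/
theorem exists_seq_tendsto_gaussLamGraph
    {U : WithLp 2 (Lp ℝ 2 (gaussLamMeasure lam) × Lp (EuclideanSpace ℝ (Fin 2)) 2 (gaussLamMeasure lam))}
    (hU : U ∈ gaussLamFormDomain lam) :
    ∃ φ : ℕ → planarTestFunctions, Tendsto (fun n => gaussLamGraph lam (φ n)) atTop (𝓝 U) := by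
  have hUc : U ∈ closure ((LinearMap.range (gaussLamGraph lam) : Submodule ℝ _) : Set _) := by
    rw [← Submodule.topologicalClosure_coe]; exact hU
  obtain ⟨a, ha, hal⟩ := mem_closure_iff_seq_limit.1 hUc
  have hex : ∀ n, ∃ φ : planarTestFunctions, gaussLamGraph lam φ = a n := fun n => by
    have := ha n
    rwa [SetLike.mem_coe, LinearMap.mem_range] at this
  choose φ hφ using hex
  refine ⟨φ, ?_⟩
  have : (fun n => gaussLamGraph lam (φ n)) = a := funext hφ
  rw [this]
  exact hal

omit hlam in
/-- `x ↦ |x|²` is measurable. [folklore] -/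
theorem measurable_norm_sq_fin_two : Measurable fun x : EuclideanSpace ℝ (Fin 2) => ‖x‖ ^ 2 :=
  (continuous_norm.pow 2).measurable

/-- **Moment bound on the form domain `H¹(μ_λ)`**: for `U = (u, ∇u) ∈ H¹(μ_λ)` the function
`|x|² u² ρ_λ` is integrable and `∫ |x|² u² ρ_λ ≤ (16/(1−λ)²)‖∇u‖² + (8/(1−λ))‖u‖²` (norms in
`L²(μ_λ)`): the moment bound for test functions passes to the closure by Fatou along a
subsequence converging a.e. (`lintegral_weight_mul_sq_le_of_tendsto_Lp`). Consequently the
drift term `u b_λ` of the weak vorticity gradient `∇(ρ_λu) = ρ_λ(∇u − u b_λ)`, `|b_λ| ≤ |x|`,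
lies in `L²(μ_λ)`. [folklore] -/
theorem integral_norm_sq_mul_sq_le_of_mem_gaussLamFormDomain
    {U : WithLp 2 (Lp ℝ 2 (gaussLamMeasure lam) × Lp (EuclideanSpace ℝ (Fin 2)) 2 (gaussLamMeasure lam))}
    (hU : U ∈ gaussLamFormDomain lam) :
    Integrable (fun x : EuclideanSpace ℝ (Fin 2) => ‖x‖ ^ 2 * (U.fst : EuclideanSpace ℝ (Fin 2) → ℝ) x ^ 2 *
        Real.exp (-((1 + lam) / 4 * x 0 ^ 2 + (1 - lam) / 4 * x 1 ^ 2))) ∧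
      ∫ x : EuclideanSpace ℝ (Fin 2), ‖x‖ ^ 2 * (U.fst : EuclideanSpace ℝ (Fin 2) → ℝ) x ^ 2 *
          Real.exp (-((1 + lam) / 4 * x 0 ^ 2 + (1 - lam) / 4 * x 1 ^ 2)) ≤
        16 / (1 - lam) ^ 2 * ‖U.snd‖ ^ 2 + 8 / (1 - lam) * ‖U.fst‖ ^ 2 := by
  have hq : 0 < 1 - lam := by linarith [hlam.2]
  obtain ⟨φ, hlim⟩ := exists_seq_tendsto_gaussLamGraph hU
  have h1 : Tendsto (fun n => (gaussLamGraph lam (φ n)).fst) atTop (𝓝 U.fst) :=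
    ((WithLp.continuous_fst _ _ _).tendsto U).comp hlim
  have h2 : Tendsto (fun n => (gaussLamGraph lam (φ n)).snd) atTop (𝓝 U.snd) :=
    ((WithLp.continuous_snd _ _ _).tendsto U).comp hlim
  set C : ℕ → ℝ := fun n => 16 / (1 - lam) ^ 2 * ‖(gaussLamGraph lam (φ n)).snd‖ ^ 2 +
    8 / (1 - lam) * ‖(gaussLamGraph lam (φ n)).fst‖ ^ 2 with hC_def
  have hCl : Tendsto C atTop (𝓝 (16 / (1 - lam) ^ 2 * ‖U.snd‖ ^ 2 + 8 / (1 - lam) * ‖U.fst‖ ^ 2)) :=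
    (((h2.norm).pow 2).const_mul _).add (((h1.norm).pow 2).const_mul _)
  -- the bound for each graph, as a `lintegral` against `μ_λ`
  have hC : ∀ n, ∫⁻ x, ENNReal.ofReal (‖x‖ ^ 2 *
      ((gaussLamGraph lam (φ n)).fst : EuclideanSpace ℝ (Fin 2) → ℝ) x ^ 2) ∂gaussLamMeasure lam ≤
      ENNReal.ofReal (C n) := by
    intro n
    have hae := MemLp.coeFn_toLp (memLp_planarTestFunction lam (φ n))
    have hψc := planarTestFunctions.continuous (φ n)
    have hψs := planarTestFunctions.hasCompactSupport (φ n)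
    have hint : Integrable (fun x : EuclideanSpace ℝ (Fin 2) =>
        ‖x‖ ^ 2 * (φ n : EuclideanSpace ℝ (Fin 2) → ℝ) x ^ 2) (gaussLamMeasure lam) := by
      rw [integrable_gaussLamMeasure_iff]
      exact (((continuous_norm.pow 2).mul (hψc.pow 2)).mul
        (continuous_expNegQuadLam lam)).integrable_of_hasCompactSupport (hψs.mono (by
          intro x hx
          simp only [Function.mem_support, ne_eq] at hx ⊢
          contrapose! hx
          simp [hx]))
    have hbound := integral_norm_sq_mul_sq_mul_expNegQuadLam_le hlam (φ n)
    rw [← norm_sq_gaussLamGraph_fst, ← norm_sq_gaussLamGraph_snd, ← integral_gaussLamMeasure] at hbound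
    calc ∫⁻ x, ENNReal.ofReal (‖x‖ ^ 2 *
          ((gaussLamGraph lam (φ n)).fst : EuclideanSpace ℝ (Fin 2) → ℝ) x ^ 2) ∂gaussLamMeasure lam
        = ∫⁻ x, ENNReal.ofReal (‖x‖ ^ 2 * (φ n : EuclideanSpace ℝ (Fin 2) → ℝ) x ^ 2)
            ∂gaussLamMeasure lam := by
          refine lintegral_congr_ae ?_
          filter_upwards [hae] with x hx
          rw [gaussLamGraph_fst, hx]
      _ = ENNReal.ofReal (∫ x, ‖x‖ ^ 2 * (φ n : EuclideanSpace ℝ (Fin 2) → ℝ) x ^ 2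
            ∂gaussLamMeasure lam) :=
          (ofReal_integral_eq_lintegral_ofReal hint (Eventually.of_forall fun x => by positivity)).symm
      _ ≤ ENNReal.ofReal (C n) := ENNReal.ofReal_le_ofReal hbound
  have key := lintegral_weight_mul_sq_le_of_tendsto_Lp h1 measurable_norm_sq_fin_two hC hCl
  -- integrability and the bound for `U`
  have hc0 : 0 ≤ 16 / (1 - lam) ^ 2 * ‖U.snd‖ ^ 2 + 8 / (1 - lam) * ‖U.fst‖ ^ 2 := by positivity
  have hmeas : AEStronglyMeasurable (fun x : EuclideanSpace ℝ (Fin 2) =>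
      ‖x‖ ^ 2 * (U.fst : EuclideanSpace ℝ (Fin 2) → ℝ) x ^ 2) (gaussLamMeasure lam) :=
    (continuous_norm.pow 2).aestronglyMeasurable.mul ((Lp.aestronglyMeasurable _).pow 2)
  have hnn : 0 ≤ᵐ[gaussLamMeasure lam] fun x : EuclideanSpace ℝ (Fin 2) =>
      ‖x‖ ^ 2 * (U.fst : EuclideanSpace ℝ (Fin 2) → ℝ) x ^ 2 :=
    Eventually.of_forall fun x => by positivity
  have hintμ : Integrable (fun x : EuclideanSpace ℝ (Fin 2) =>
      ‖x‖ ^ 2 * (U.fst : EuclideanSpace ℝ (Fin 2) → ℝ) x ^ 2) (gaussLamMeasure lam) := by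
    refine ⟨hmeas, ?_⟩
    rw [hasFiniteIntegral_iff_enorm]
    calc ∫⁻ x, ‖‖x‖ ^ 2 * (U.fst : EuclideanSpace ℝ (Fin 2) → ℝ) x ^ 2‖ₑ ∂gaussLamMeasure lam
        = ∫⁻ x, ENNReal.ofReal (‖x‖ ^ 2 * (U.fst : EuclideanSpace ℝ (Fin 2) → ℝ) x ^ 2)
            ∂gaussLamMeasure lam :=
          lintegral_congr fun x => Real.enorm_eq_ofReal (by positivity)
      _ ≤ _ := key
      _ < ⊤ := ENNReal.ofReal_lt_top
  refine ⟨(integrable_gaussLamMeasure_iff lam).1 hintμ, ?_⟩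
  rw [← integral_gaussLamMeasure, integral_eq_lintegral_of_nonneg_ae hnn hmeas]
  exact ENNReal.toReal_le_of_le_ofReal hc0 key

end FormDomain

end Literature.Analysis.FluidPDE
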